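import Summits.HodgeConjecture.HodgeConjecture.Theorems.MarkmanPartnerTransportPicardThreeK3SquaresPicardTwelveSqrtTwoSector
import Summits.HodgeConjecture.HodgeConjecture.Theorems.MarkmanPartnerTransportPicardThreeK3SquaresPicardElevenSqrtTwo

/-!
# Route MarkmanPartnerTransport · crux `PicardThreeK3Squares` (stmt-HodgeConjecture-19652) —
# the Hodge conjecture for `S × S` for EVERY projective K3 surface of Picard rank `≥ 12` with real
# multiplication by `√2`, modulo named facts

`…PicardElevenSqrtTwo` proves HC⁴(S ⊗ S) at `ρ(S) ≥ 11` from the `√2`-sector data (a Hodge similitude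
`ψ` of `T(S)` of multiplier `2` AND the clause `End_Hdg(T(S)) ⊆ ℚ + ℚψ`); `…PicardTwelveSqrtTwoSector`
shows the clause is automatic at `ρ(S) ≥ 12` unless `S` has complex multiplication, in which case
HC⁴(S ⊗ S) is Buskin's (`CMThird.hodgeConjectureFor_square_of_CM_of_buskin`). Hence:

* `hodgeConjectureFor_square_of_twelve_le_of_sqrtTwo` (+ marking-free `…'`) — **every projective K3
  surface `S` with `ρ(S) ≥ 12` whose `H²` carries a rational Hodge endomorphism `ψ` with `ψ² = 2` and
  multiplier `2` on `T(S)` — e.g. EVERY projective K3 surface of Picard rank `12, 14` or `16` with real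
  multiplication by `ℚ(√2)` — satisfies `HodgeConjectureFor 4 (S ⊗ S)`**, modulo
  `Buskin2019_hodgeIsometry_algebraic`, `Huybrechts_K3_marking_exists`,
  `Huybrechts_K3_periodSurjective_projective`, `Varesco2023_sqrtMultiplication_algebraic_of_symplecticAutomorphism`,
  `VanGeemenSarti2007_nikulinInvolution_of_primitiveE8`. In print the `ℚ(√2)` case was known for K3
  surfaces WITH a Nikulin involution (Varesco 2023 Thm. 2.1/2.9, four-dimensional families at `ρ = 10`)
  and for the van Geemen–Schütt cycle-induced families.

No definition, no sorry. Prover seat hodge-nonav-19652-p1 (gen 3), `--supports stmt-HodgeConjecture-19652`.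

References: M. Varesco, Math. Z. 305 (2023), Thm. 2.1, Prop. 2.5, Thm. 2.9, Rem. 2.10; B. van Geemen,
A. Sarti, Math. Z. 255 (2007), Prop. 2.3; B. van Geemen, Michigan Math. J. 56 (2008), Lemma 3.2;
N. Buskin, J. reine angew. Math. 755 (2019), Thm. 1.1.
-/

set_option linter.dupNamespace false

noncomputable section

namespace Summit.HodgeConjecture.HodgeConjecture.Theorems.MarkmanPartnerTransport.NikulinIsogeny

open scoped TensorProduct IntermediateField
open Module CategoryTheory MonoidalCategory
open Literature.AlgebraicGeometry Literature.AlgebraicGeometry.Motives Literature.AlgebraicGeometry.HodgeTheory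
open Literature.AlgebraicGeometry.Motives.HodgeStructure
open Literature.AlgebraicGeometry.Surfaces
open Literature.AlgebraicTopology.SingularHomology
open Summit.HodgeConjecture.HodgeConjecture.Theorems
open Summit.HodgeConjecture.HodgeConjecture.Theorems.NikulinTwinTransport
open Summit.HodgeConjecture.HodgeConjecture.Theorems.AnchorExistenceCMFloor
open Summit.HodgeConjecture.HodgeConjecture.Theorems.MarkmanPartnerTransport.RealMultiplicationRanks

variable {S : SchemeOver ℂ}

/-- `MarkedK3[S, η, p, x]`: VERBATIM the `let MarkedK3 := …` binder of the route declaration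
`PicardThreeK3Squares`. Local notation only. -/
local notation3 (prettyPrint := false) "MarkedK3[" S ", " η ", " p ", " x "]" =>
  (p ≠ 0 ∧ (IsIntegralClass p ∧
    (∀ q : complexBetti S (2 * 2), IsIntegralClass q → ∃ n : ℤ, q = n • p) ∧
    (∀ c : complexBetti S (2 * 1), IsIntegralClass c ↔ ∃ v : K3Index → ℤ, η c = fun i => (v i : ℂ)) ∧
    (∀ a b : complexBetti S (2 * 1),
      cupProduct (rfl : 2 * 1 + 2 * 1 = 2 * 2) a b = k3Form (η a) (η b) • p) ∧
    IsOfHodgeType 2 S (2 * 1) 2 0 (LinearEquiv.symm η x) ∧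
    (∀ τ : complexBetti S (2 * 1), IsOfHodgeType 2 S (2 * 1) 2 0 τ →
      ∃ t : ℂ, τ = t • LinearEquiv.symm η x)) ∧
    (k3Form x x = 0 ∧ 0 < (k3Form (star x) x).re ∧
      ∃ u : K3Index → ℤ, k3Form (fun i => (u i : ℂ)) x = 0 ∧ 0 < ∑ i, ∑ j, u i * k3Gram i j * u j))

/-- `SqrtSector[S, ψ]`: the `√2`-sector data of `SymplecticLocus.hodgeConjectureFor_square_of_isNikulinInvolution`
(as in `…PicardElevenSqrtTwo`). Local notation only. -/
local notation3 (prettyPrint := false) "SqrtSector[" S ", " ψ "]" =>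
  (Set.MapsTo ψ (transcendentalSubspace S) (transcendentalSubspace S) ∧
    (∀ x ∈ transcendentalSubspace S, IsRationalClass x → IsRationalClass (ψ x)) ∧
    (∀ (i j : ℕ), ∀ x ∈ transcendentalSubspace S,
      IsOfHodgeType 2 S (2 * 1) i j x → IsOfHodgeType 2 S (2 * 1) i j (ψ x)) ∧
    (∀ x ∈ transcendentalSubspace S, ψ (ψ x) = (2 : ℂ) • x) ∧
    (∀ x ∈ transcendentalSubspace S, ∀ y ∈ transcendentalSubspace S,
      cupProduct (rfl : 2 * 1 + 2 * 1 = 2 * 2) (ψ x) (ψ y) =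
        (2 : ℂ) • cupProduct (rfl : 2 * 1 + 2 * 1 = 2 * 2) x y) ∧
    (∀ (f : complexBetti S (2 * 1) →ₗ[ℂ] complexBetti S (2 * 1)),
      (∀ y, IsRationalClass y → IsRationalClass (f y)) →
      (∀ (i j : ℕ) y, IsOfHodgeType 2 S (2 * 1) i j y → IsOfHodgeType 2 S (2 * 1) i j (f y)) →
      (∀ d ∈ algebraicClasses S 1, f d = 0) →
      (∀ y : complexBetti S (2 * 1), ∀ d ∈ algebraicClasses S 1,
        cupProduct (rfl : 2 * 1 + 2 * 1 = 2 * 2) (f y) d = 0) →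
      ∃ a b : ℚ, ∀ y : complexBetti S (2 * 1),
        (∀ d ∈ algebraicClasses S 1, cupProduct (rfl : 2 * 1 + 2 * 1 = 2 * 2) y d = 0) →
        f y = (a : ℂ) • y + (b : ℂ) • ψ y))


/-! ### The Hodge conjecture for `S × S`, `ρ(S) ≥ 12`, from a `√2`-similitude alone -/

/-- **HC⁴(S ⊗ S) for every marked projective K3 surface with `ρ(S) ≥ 12` whose `H²` carries a rational
Hodge endomorphism `ψ` with `ψ² = 2` and multiplier `2` on `T(S)`** — e.g. EVERY projective K3 surface of
Picard rank `12, 14` or `16` with real multiplication by `ℚ(√2)` — modulo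
`Buskin2019_hodgeIsometry_algebraic`, `Huybrechts_K3_marking_exists`, `Huybrechts_K3_periodSurjective_projective`,
`Varesco2023_sqrtMultiplication_algebraic_of_symplecticAutomorphism`, `VanGeemenSarti2007_nikulinInvolution_of_primitiveE8`:
either `S` has complex multiplication (Buskin: `CMThird.hodgeConjectureFor_square_of_CM_of_buskin`), or the
`√2`-sector data hold (`sqrtSector_or_hasComplexMultiplication`) and
`hodgeConjectureFor_square_of_eleven_le_of_sqrtTwo` applies. [cite: Varesco2023, Thm. 2.1, Prop. 2.5, Rem. 2.10]
[cite: Vangeemen2008, Lemma 3.2] [cite: Buskin2019, Thm. 1.1 and Corollary] -/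
theorem hodgeConjectureFor_square_of_twelve_le_of_sqrtTwo (hB : Buskin2019_hodgeIsometry_algebraic)
    (hmark : Huybrechts_K3_marking_exists) (hPS : Huybrechts_K3_periodSurjective_projective)
    (hV : Varesco2023_sqrtMultiplication_algebraic_of_symplecticAutomorphism)
    (hGS : VanGeemenSarti2007_nikulinInvolution_of_primitiveE8)
    (hS : IsK3Surface S)
    (η : complexBetti S (2 * 1) ≃ₗ[ℂ] (K3Index → ℂ)) (p : complexBetti S (2 * 2)) (x : K3Index → ℂ)
    (hM : MarkedK3[S, η, p, x]) (hρ : 12 ≤ Module.finrank ℂ ↥(algebraicClasses S 1))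
    (ψ : complexBetti S (2 * 1) →ₗ[ℂ] complexBetti S (2 * 1))
    (hψrat : ∀ y, IsRationalClass y → IsRationalClass (ψ y))
    (hψtyp : ∀ (i j : ℕ) y, IsOfHodgeType 2 S (2 * 1) i j y → IsOfHodgeType 2 S (2 * 1) i j (ψ y))
    (hψsq : ∀ y ∈ transcendentalSubspace S, ψ (ψ y) = (2 : ℂ) • y)
    (hψmul : ∀ y ∈ transcendentalSubspace S, ∀ z ∈ transcendentalSubspace S,
      cupProduct (rfl : 2 * 1 + 2 * 1 = 2 * 2) (ψ y) (ψ z) =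
        (2 : ℂ) • cupProduct (rfl : 2 * 1 + 2 * 1 = 2 * 2) y z) :
    HodgeConjectureFor 4 (S ⊗ S) := by
  rcases sqrtSector_or_hasComplexMultiplication hS η p x hM hρ ψ hψrat hψtyp hψsq hψmul with hsec | hCM
  · exact hodgeConjectureFor_square_of_eleven_le_of_sqrtTwo hB hPS hV hGS hS η p x hM (by omega) ψ hsec
  · exact CMThird.hodgeConjectureFor_square_of_CM_of_buskin hB hmark S hS hCM

/-- **Marking-free form: every projective K3 surface of Picard rank `≥ 12` whose `H²` carries a rational
Hodge endomorphism `ψ` with `ψ² = 2` and multiplier `2` on `T(S)` (real multiplication by `√2`) satisfies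
the Hodge conjecture for `S ⊗ S`**, modulo the five named facts. [cite: Varesco2023, Thm. 2.1 and Prop. 2.5]
[cite: Vangeemen2008, Lemma 3.2] [cite: VanGeemenSarti2007, Prop. 2.3] -/
theorem hodgeConjectureFor_square_of_twelve_le_of_sqrtTwo' (hB : Buskin2019_hodgeIsometry_algebraic)
    (hmark : Huybrechts_K3_marking_exists) (hPS : Huybrechts_K3_periodSurjective_projective)
    (hV : Varesco2023_sqrtMultiplication_algebraic_of_symplecticAutomorphism)
    (hGS : VanGeemenSarti2007_nikulinInvolution_of_primitiveE8)
    (hS : IsK3Surface S) (hρ : 12 ≤ Module.finrank ℂ ↥(algebraicClasses S 1))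
    (ψ : complexBetti S (2 * 1) →ₗ[ℂ] complexBetti S (2 * 1))
    (hψrat : ∀ y, IsRationalClass y → IsRationalClass (ψ y))
    (hψtyp : ∀ (i j : ℕ) y, IsOfHodgeType 2 S (2 * 1) i j y → IsOfHodgeType 2 S (2 * 1) i j (ψ y))
    (hψsq : ∀ y ∈ transcendentalSubspace S, ψ (ψ y) = (2 : ℂ) • y)
    (hψmul : ∀ y ∈ transcendentalSubspace S, ∀ z ∈ transcendentalSubspace S,
      cupProduct (rfl : 2 * 1 + 2 * 1 = 2 * 2) (ψ y) (ψ z) =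
        (2 : ℂ) • cupProduct (rfl : 2 * 1 + 2 * 1 = 2 * 2) y z) :
    HodgeConjectureFor 4 (S ⊗ S) := by
  obtain ⟨η, p, x, hM⟩ := hmark S hS
  exact hodgeConjectureFor_square_of_twelve_le_of_sqrtTwo hB hmark hPS hV hGS hS η p x hM hρ ψ hψrat hψtyp
    hψsq hψmul

end Summit.HodgeConjecture.HodgeConjecture.Theorems.MarkmanPartnerTransport.NikulinIsogeny

end
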